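import Literature.NumberTheory.LFunctions.KMVHighDerivativeNonvanishing
import Literature.NumberTheory.LFunctions.MollifierOptimality
import HarnessLib

/-!
# The Cauchy–Schwarz proportion of a one-piece linear mollifier in the harmonic family `S₂(q)*`
# and the (OPEN) optimality of the Iwaniec–Sarnak / KMV profile among arbitrary coefficients

Topic `Literature/NumberTheory/LFunctions` (namespace `Literature.NumberTheory.LFunctions.KMV2000`,
continuing `KMVMollifiedMomentForms.lean` / `KMVHighDerivativeNonvanishing.lean`). Typed for the
LANDAU–SIEGEL PROGRAMME, cell `landau-siegel`, sub-cell §B-fam, row **famE-09** of `B-fam/EDLIST.md`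
("GL(2) analogue of Čech–Matomäki 2025 Thm 1.1: over `f ∈ H_k(N)` harmonic, for ANY coefficients
`x_m`, `x₁ = 1`, `x_m ≪ N^ε`, `m ≤ M = q̂^Δ`, `Δ < 1`, the C-S proportion `≤ Δ/(1+Δ) + o(1)`
(even-forms scale) — NOT found in print; statement by ls-Bfam-typer-1 as a NAMED OPEN Prop = the hard
half of the §E class statement"). This file introduces NO theorem-in-print fact; its one `Prop`
(`LinearMollifierOptimality`) is explicitly OPEN and asserted by no one (pattern of the tree's
`Zhang2022.KnifeEdge.Eq148DUniform`). FRAMING: the programme SEARCHES and TYPES; nothing here is a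
claim about Landau–Siegel zeros.

## What is typed, over the tree's vocabulary of record

Family `S₂(q)* = newforms0 q 2` (`q` prime, weight 2), harmonic weights and central values of record
`IwaniecSarnak.harmonicWeight`, `IwaniecSarnak.centralValue` (p456172), the general one-piece linear
mollifier `KowalskiMichel2000.mollifier x M f = Σ_{1≤m≤M} x_m m^{−1/2} λ_f(m)` (p458185), the KMV
length `M = q̂^Δ`, `q̂ = √q/2π` (`KMV2000.qhat`, p459231), the growth class "`x_m ≪ q^ε`"
(`CechMatomaki2025.CoeffBound`, p455594) and the abstract Cauchy–Schwarz functional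
`CechMatomaki2025.beta` (`β(M) = |𝔼^w[LM]|²/𝔼^w[|LM|²]`, [CechMatomaki2025, §2]):

* `famFinset q` — `S₂(q)*` as a `Finset` (finite by the tree theorem `finite_newforms0_holds`);
* `harmonicBeta q M` — `β^h_q(M) := |Σ^h ω_f L(f,½)M(f)|² / (Σ^h ω_f · Σ^h ω_f |L(f,½)M(f)|²)`, the
  harmonic Cauchy–Schwarz functional ("Hence `Σ^h_{Λ(f,½)≠0} 1 ≥ L(x)²/Q(x)`",
  [KowalskiMichelVanderKam2000, §2 p. 6]); PROVED: `0 ≤ β^h ≤ 1` and the mollifier principle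
  `harmonicBeta_le_proportion` (the `ω`-proportion of `{L(f,½) ≠ 0}` is `≥ β^h_q(M)` for every `M`),
  from the tree's `CechMatomaki2025.beta_le_nonvanishingProportion`;
* `LinearMollifierOptimality` — **OPEN IN PRINT**: for `0 < Δ < 1`, uniformly over real `x` with
  `x_1 = 1`, `|x_m| ≤ C(ε)q^ε`: `β^h_q(Σ_{m ≤ q̂^Δ} x_m m^{−1/2}λ_f(m)) ≤ Δ/(2(1+Δ)) + o(1)` as
  `q → ∞` through primes (all-forms scale; `= Δ/(1+Δ)` of the even forms). Nearest print: the
  `GL(1)` theorem [CechMatomaki2025, Thm 1.1 (ii)] (tree fact `cechMatomaki2025_theorem11`) and its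
  authors' remark that "proofs of optimality of mollifiers are very sparse" [CechMatomaki2025,
  Remark 1.2]; for derivatives at prime level, Iwaniec–Kowalski §26.4 optimise over general vectors
  `(x_m)` for a diagonalised reference form and state, without proof, that the choice is
  asymptotically optimal for the whole quadratic form [IwaniecKowalski2004, §26.4]. Its
  PROFILE-CLOSURE half (coefficients of KMV's shape (9) with a polynomial profile) IS a theorem:
  `KMV2000.ratio_one_le` (`sup_P R(P,1;Δ) = Δ/(2(1+Δ))`, attained by `P₀ = x²`,
  `KMV2000.ratio_one_X_sq`);
* `harmonicBeta_lt_quarter_of_optimality` — PROVED bookkeeping: under `LinearMollifierOptimality`,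
  at every fixed `Δ < 1` every admissible one-piece linear mollifier has `β^h_q < 1/4` for large `q`
  (`KMV2000.envelope_lt_quarter_iff`), i.e. the one-piece class cannot certify more than one quarter of
  all forms (one half of the even ones) at main order inside the printed range — the content of
  [KowalskiMichelVanderKam2000, §8.4 p. 28] "the absolute limit of our method, barring any
  improvement in the (logarithmic) length of the mollifier `Δ` beyond `1`", made a class statement.

## References

* [KowalskiMichelVanderKam2000] §2 p. 6 (the Cauchy–Schwarz step), (9), Thm 6.1, §8.4 p. 28.
* [CechMatomaki2025] Thm 1.1, Remark 1.2, §2 (2.1), Cor. 2.6. [IwaniecKowalski2004] §26.4.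
-/

noncomputable section

open scoped MatrixGroups
open CongruenceSubgroup Finset
open Literature.NumberTheory.EllipticCurves.ModularForms

namespace Literature.NumberTheory.LFunctions.KMV2000

/-- The finite set `S₂(q)* = newforms0 q 2` of Hecke-normalised newforms of weight 2 and level
`Γ₀(q)` (finite by the tree theorem `finite_newforms0_holds`).
[cite: KowalskiMichelVanderKam2000, §1 p. 1] -/
def famFinset (q : ℕ) [NeZero q] : Finset (CuspForm (Gamma0 q) 2) :=
  (finite_newforms0_holds q 2).toFinset

/-- Membership in `famFinset q` is membership in `newforms0 q 2`.
[cite: KowalskiMichelVanderKam2000, §1 p. 1] -/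
theorem mem_famFinset {q : ℕ} [NeZero q] {f : CuspForm (Gamma0 q) 2} :
    f ∈ famFinset q ↔ f ∈ newforms0 q 2 :=
  (finite_newforms0_holds q 2).mem_toFinset

/-- **The harmonic Cauchy–Schwarz functional** `β^h_q(M) = |Σ^h L(f,½)M(f)|² / (Σ^h 1 · Σ^h |L(f,½)M(f)|²)`
of a "mollifier" `M : S₂(q)* → ℂ` — the tree's abstract `CechMatomaki2025.beta`
(`|𝔼^w[LM]|²/𝔼^w[|LM|²]`) for the family `S₂(q)*` with the harmonic weights of record
`w = IwaniecSarnak.harmonicWeight` and values `L = IwaniecSarnak.centralValue`. It is the main-order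
object "`L(x)²/Q(x)`" of the source ("Hence `Σ^h_{Λ(f,½)≠0} 1 ≥ L(x)²/Q(x)`", p. 6), normalised by
the harmonic mass. [cite: KowalskiMichelVanderKam2000, §2 p. 6] -/
def harmonicBeta (q : ℕ) [NeZero q] (M : CuspForm (Gamma0 q) 2 → ℂ) : ℝ :=
  CechMatomaki2025.beta (ι := ↥(famFinset q)) (fun f => IwaniecSarnak.harmonicWeight f.1)
    (fun f => IwaniecSarnak.centralValue f.1) (fun f => M f.1)

/-- `β^h_q(M) ≥ 0`. [cite: CechMatomaki2025, §2] -/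
theorem harmonicBeta_nonneg (q : ℕ) [NeZero q] (M : CuspForm (Gamma0 q) 2 → ℂ) :
    0 ≤ harmonicBeta q M :=
  CechMatomaki2025.beta_nonneg (ι := ↥(famFinset q)) (w := fun f => IwaniecSarnak.harmonicWeight f.1)
    (L := fun f => IwaniecSarnak.centralValue f.1)
    (fun f => IwaniecSarnak.harmonicWeight_nonneg le_rfl f.1) (fun f => M f.1)

/-- `β^h_q(M) ≤ 1`. [cite: CechMatomaki2025, §2 (2.1)] -/
theorem harmonicBeta_le_one (q : ℕ) [NeZero q] (M : CuspForm (Gamma0 q) 2 → ℂ) :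
    harmonicBeta q M ≤ 1 :=
  CechMatomaki2025.beta_le_one (ι := ↥(famFinset q)) (w := fun f => IwaniecSarnak.harmonicWeight f.1)
    (L := fun f => IwaniecSarnak.centralValue f.1)
    (fun f => IwaniecSarnak.harmonicWeight_nonneg le_rfl f.1) (fun f => M f.1)

open scoped Classical in
/-- **The mollifier principle in the harmonic family** ("Hence `Σ^h_{Λ(f,½)≠0} 1 ≥ L(x)²/Q(x)`",
p. 6; [CechMatomaki2025, (2.1)]): for EVERY `M`, the `ω`-proportion of `{f ∈ S₂(q)* : L(f,½) ≠ 0}`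
is at least `β^h_q(M)`. PROVED from the tree's `CechMatomaki2025.beta_le_nonvanishingProportion`.
[cite: KowalskiMichelVanderKam2000, §2 p. 6] -/
theorem harmonicBeta_le_proportion (q : ℕ) [NeZero q] (M : CuspForm (Gamma0 q) 2 → ℂ) :
    harmonicBeta q M ≤
      (∑ f ∈ (famFinset q).attach,
          if IwaniecSarnak.centralValue f.1 = 0 then 0 else IwaniecSarnak.harmonicWeight f.1) /
        ∑ f ∈ (famFinset q).attach, IwaniecSarnak.harmonicWeight f.1 := by
  have h := CechMatomaki2025.beta_le_nonvanishingProportion (ι := ↥(famFinset q))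
    (w := fun f => IwaniecSarnak.harmonicWeight f.1) (L := fun f => IwaniecSarnak.centralValue f.1)
    (fun f => IwaniecSarnak.harmonicWeight_nonneg le_rfl f.1) (fun f => M f.1)
  simpa [harmonicBeta, CechMatomaki2025.nonvanishingProportion, CechMatomaki2025.totalWeight,
    Finset.univ_eq_attach] using h

/-! ### Row famE-09: optimality of the one-piece choice (OPEN, not in print) -/

/-- **OPEN IN PRINT — the `GL(2)` one-piece optimality statement (cell row famE-09).** For every
`0 < Δ < 1` and every growth budget `C`: uniformly over REAL coefficient sequences `x` with
`x_1 = 1` and `|x_m| ≤ C(ε) q^ε` (all `ε > 0`, `m ≥ 1`; the tree's `CechMatomaki2025.CoeffBound`),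
the harmonic Cauchy–Schwarz functional of the one-piece linear mollifier
`Σ_{1 ≤ m ≤ q̂^Δ} x_m m^{−1/2} λ_f(m)` (the tree's `KowalskiMichel2000.mollifier x (q̂^Δ)`,
`q̂ = KMV2000.qhat q = √q/2π`) over `S₂(q)*` satisfies `β^h_q ≤ Δ/(2(1+Δ)) + ε₂` for all large
primes `q` — i.e. no admissible one-piece linear mollifier of logarithmic length `Δ` beats the
KMV/IS profile `P₀ = x²` at main order (whose value is `Δ/(2(1+Δ)) = KMV2000.envelope Δ`, attained:
`KMV2000.ratio_one_X_sq`; `< 1/4` for every `Δ < 1`: `KMV2000.envelope_lt_quarter_iff`).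
STATUS: NOT a theorem in print and asserted by no one; designs of family B-fam and the §E class
statement «no one-piece design closes for `Δ < 1`» take it as a NAMED hypothesis / target. Nearest
printed results: the `GL(1)` analogue [CechMatomaki2025, Thm 1.1 (ii)] (tree fact
`cechMatomaki2025_theorem11`: one-piece mollifiers of `L(½,χ)`, `θ < ½`, `β_q(N_G) ≤ 1/(1+1/θ)+o(1)`),
whose authors note "proofs of optimality of mollifiers are very sparse" [CechMatomaki2025,
Remark 1.2]; the abstract criterion [CechMatomaki2025, Cor. 2.6] (tree theorem
`CechMatomaki2025.beta_add_smul_le`) with the twisted harmonic moments behind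
[KowalskiMichelVanderKam2000, Props 4.1/5.1] is the natural route; for derivatives Iwaniec–Kowalski
§26.4 optimise over general vectors `(x_m)` for a diagonalised reference form and state, without
proof, asymptotic optimality for the whole quadratic form [IwaniecKowalski2004, §26.4]. The
PROFILE-CLOSURE half (KMV's shape (9) with a polynomial `P`) IS the theorem `KMV2000.ratio_one_le`.
[cite: CechMatomaki2025, Theorem 1.1 (ii) and Remark 1.2 (the GL(1) statement; this GL(2) analogue is NOT in print)] -/
def LinearMollifierOptimality : Prop :=
  ∀ Δ : ℝ, 0 < Δ → Δ < 1 → ∀ C : ℝ → ℝ, ∀ ε₂ : ℝ, 0 < ε₂ → ∃ q₀ : ℕ,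
    ∀ (q : ℕ) [NeZero q], q.Prime → q₀ ≤ q → ∀ x : ℕ → ℝ, x 1 = 1 →
      CechMatomaki2025.CoeffBound C q (fun m => (x m : ℂ)) →
        harmonicBeta q (KowalskiMichel2000.mollifier x (qhat q ^ Δ)) ≤ Δ / (2 * (1 + Δ)) + ε₂

/-- Under `LinearMollifierOptimality`, at every fixed `0 < Δ < 1` the harmonic Cauchy–Schwarz
functional of ANY admissible one-piece linear mollifier of length `q̂^Δ` is eventually `< 1/4`
(one quarter of all forms = one half of the even ones): the bound `Δ/(2(1+Δ)) = KMV2000.envelope Δ`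
is `< 1/4` iff `Δ < 1` (`KMV2000.envelope_lt_quarter_iff`). PROVED (conditional bookkeeping; the
hypothesis is OPEN) — "the absolute limit of our method, barring any improvement in the (logarithmic)
length of the mollifier `Δ` beyond `1`". [cite: KowalskiMichelVanderKam2000, §8.4 p. 28] -/
theorem harmonicBeta_lt_quarter_of_optimality (h : LinearMollifierOptimality) {Δ : ℝ} (hΔ : 0 < Δ)
    (hΔ1 : Δ < 1) (C : ℝ → ℝ) :
    ∃ q₀ : ℕ, ∀ (q : ℕ) [NeZero q], q.Prime → q₀ ≤ q → ∀ x : ℕ → ℝ, x 1 = 1 →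
      CechMatomaki2025.CoeffBound C q (fun m => (x m : ℂ)) →
        harmonicBeta q (KowalskiMichel2000.mollifier x (qhat q ^ Δ)) < 1 / 4 := by
  have hgap : 0 < 1 / 4 - envelope Δ := by
    have := (envelope_lt_quarter_iff hΔ.le).mpr hΔ1
    linarith
  obtain ⟨q₀, hq₀⟩ := h Δ hΔ hΔ1 C ((1 / 4 - envelope Δ) / 2) (by positivity)
  refine ⟨q₀, fun q _ hq hqq x hx hC => ?_⟩
  have hle := hq₀ q hq hqq x hx hC
  have : Δ / (2 * (1 + Δ)) = envelope Δ := rfl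
  rw [this] at hle
  linarith

end Literature.NumberTheory.LFunctions.KMV2000
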